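import Mathlib
import Summits.ABC.ABC.Theses.IUTThetaPilot
import Summits.ABC.ABC.Theorems.IUTThetaPilotThetaPartIIOfThm110
import Summits.ABC.IUTFork.Repair.RHRound4TLinear
import Literature.IUT.LogVolume.Corollary22Legendre
import Literature.IUT.LogVolume.Corollary22PartIILemmas
import Literature.NumberTheory.DiophantineGeometry.GenEllNorthcott
import Literature.IUT.LogVolume.Corollary22Thm110LegendreWindowWitness
import Literature.IUT.LogVolume.Corollary22LegendreDeepAdmissiblePairs

/-!
# Sketch — crux idea «defect-law synchronisation» (I3-LENS1, ideator abc-iut-idea-1) for crux `ThetaPartII`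
# (stmt-ABC-19678, route-ABC-IUTThetaPilot ▸ RESHAPE-4 3177a83aca8d622d)

§1 THE L1 NO-GO (kernel arithmetic): under any blur law PROPORTIONAL TO VALUATION DISCREPANCY (the Scholze–Stix reading of an
identification of two regions whose value-group coordinates differ), the blur booked along ANY synchronisation path between two
labels is at least the direct discrepancy (`discrepancy_le_pathBlur`), hence the total blur of ANY synchronisation graph anchored
at the q-pilot dominates the payoff `S_f` of the R-H cell currency (`payoff_le_totalBlur`): telescoped / second-difference /
spanning-tree / aggregate bookkeeping cannot make the count `O(h)`; the count is a property of the LAW, not of the GRAPH.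
§2 THE ONLY `O(h)` SHAPE: a bounded-DEFECT law (quasimorphism): credit is charged per COMPOSITION STEP, height-free, not per
unit of discrepancy; closing inequality over an «Euler word» (`eulerWord_closing`, Bogomolov–Zhang shape).
§3 DICTIONARY TO THE CRUX: a height-free additive defect display at admissible `(P,l)` (`DefectDisplay C`) gives
`Cor22.Thm110Legendre`, hence `ThetaPartII` by the landed chain (`thetaPartII_of_defectDisplay`, PROVED here); the OPEN content is the
CONSTRUCTION statement `DefectLawModel` (one group, one bounded-defect functional, parabolic bound uniform in the exponent) —
interface ≠ construction; typed ≠ proved; no side taken on [IUTchIII] Cor 3.12 (D-0045); NOT an abc claim.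
-/

set_option linter.dupNamespace false

namespace Summit.ABC.ABC.Cruxes.ThetaPartII.DefectLawCritA

open Literature.NumberTheory.DiophantineGeometry Literature.NumberTheory.DiophantineGeometry.GenEll
open Literature.IUT.LogVolume
open Summit.ABC.IUTFork.Repair.RH.Round4TLinear

/-! ## §1 Bookkeeping-graph invariance of discrepancy-proportional blur (the L1 no-go) -/

/-- Blur booked along a synchronisation path `γ 0 → γ 1 → … → γ n` of labels under the value law `f` (units `m_q`),
when each identification step costs the valuation discrepancy `|f(next) − f(prev)|` (SS-type law). -/
def pathBlur (f : ℕ → ℤ) (γ : ℕ → ℕ) (n : ℕ) : ℤ := ∑ i ∈ Finset.range n, |f (γ (i + 1)) - f (γ i)|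

/-- NO-GO, one path: the booked blur of any path dominates the direct discrepancy of its endpoints (triangle inequality). -/
theorem discrepancy_le_pathBlur (f : ℕ → ℤ) (γ : ℕ → ℕ) (n : ℕ) : |f (γ n) - f (γ 0)| ≤ pathBlur f γ n := by
  unfold pathBlur
  rw [← Finset.sum_range_sub (fun i => f (γ i)) n]
  exact Finset.abs_sum_le_sum_abs _ _

/-- NO-GO, whole synchronisation graph, in the R-H cell currency (`Round4TLinear.Variant`): if every label `j ∈ J` is synchronised
with the anchor label `1` (the q-pilot: `f 1 = 1`) through SOME path `γ j` of `n j` steps, the total booked blur (in `m_q` units)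
is at least the payoff `S_f(J) = Σ_J (f j − 1)`. So with blur ∝ discrepancy the volume inequality degenerates for EVERY graph. -/
theorem payoff_le_totalBlur (V : Variant) (γ : ℕ → ℕ → ℕ) (n : ℕ → ℕ) (hγ0 : ∀ j ∈ V.J, γ j 0 = 1)
    (hγn : ∀ j ∈ V.J, γ j (n j) = j) (hf1 : V.f 1 = 1) :
    S V ≤ ∑ j ∈ V.J, (pathBlur V.f (γ j) (n j) : ℝ) := by
  unfold S
  refine Finset.sum_le_sum fun j hj => ?_
  have h := discrepancy_le_pathBlur V.f (γ j) (n j)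
  rw [hγ0 j hj, hγn j hj, hf1] at h
  have h' : ((V.f j - 1 : ℤ) : ℝ) ≤ (pathBlur V.f (γ j) (n j) : ℝ) := by
    exact_mod_cast (le_abs_self _).trans h
  push_cast at h'
  exact h'

/-! ## §2 The bounded-defect law: quasimorphism closing inequality over an Euler word -/

/-- A bounded-defect functional («rotation number» shape) on a group. -/
def IsQuasimorphism {G : Type*} [Group G] (Φ : G → ℝ) (δ : ℝ) : Prop := ∀ x y : G, |Φ (x * y) - Φ x - Φ y| ≤ δ

/-- Defect accumulates per FACTOR, not per unit of value: `|Φ(Π L) − Σ Φ(L)| ≤ |L|·δ`. -/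
theorem quasimorphism_prod_le {G : Type*} [Group G] {Φ : G → ℝ} {δ : ℝ} (hΦ : IsQuasimorphism Φ δ) (h1 : Φ 1 = 0) :
    ∀ L : List G, |Φ L.prod - (L.map Φ).sum| ≤ L.length * δ := by
  intro L
  induction L with
  | nil => simp [h1]
  | cons x t ih =>
    simp only [List.prod_cons, List.map_cons, List.sum_cons, List.length_cons, Nat.cast_succ]
    have h2 := hΦ x t.prod
    have e : Φ (x * t.prod) - (Φ x + (t.map Φ).sum) = (Φ (x * t.prod) - Φ x - Φ t.prod) + (Φ t.prod - (t.map Φ).sum) := by ring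
    rw [e]
    calc |Φ (x * t.prod) - Φ x - Φ t.prod + (Φ t.prod - (t.map Φ).sum)|
        ≤ |Φ (x * t.prod) - Φ x - Φ t.prod| + |Φ t.prod - (t.map Φ).sum| := abs_add_le _ _
      _ ≤ δ + t.length * δ := add_le_add h2 ih
      _ = (t.length + 1) * δ := by ring

/-- **EULER-WORD CLOSING INEQUALITY** (Bogomolov–Zhang shape): if every letter of the word `L` («parabolic» factors, one per bad place,
whatever its exponent) has rotation `≤ β`, the boundary factor `b` has rotation `≤ B`, and the word closes on a central power
`z^k = (Π L)·b` whose rotation is EXACTLY `k·c` (the degree side), then `k·c ≤ |L|·(β+δ) + B + δ`: PRICE PER FACTOR, PAYOFF PER DEGREE. -/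
theorem eulerWord_closing {G : Type*} [Group G] {Φ : G → ℝ} {δ β B c : ℝ} (hΦ : IsQuasimorphism Φ δ) (h1 : Φ 1 = 0)
    (L : List G) (hL : ∀ x ∈ L, Φ x ≤ β) (b z : G) (hb : Φ b ≤ B) (k : ℕ) (hz : Φ (z ^ k) = k * c)
    (hrel : z ^ k = L.prod * b) : (k : ℝ) * c ≤ L.length * (β + δ) + B + δ := by
  have hsum : (L.map Φ).sum ≤ L.length * β := by
    have := List.sum_le_card_nsmul (L.map Φ) β (by simpa using hL)
    simpa [nsmul_eq_mul] using this
  have hprod : Φ L.prod ≤ L.length * β + L.length * δ := by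
    have h := (abs_le.mp (quasimorphism_prod_le hΦ h1 L)).2
    linarith
  have hzb : Φ (z ^ k) ≤ Φ L.prod + Φ b + δ := by
    rw [hrel]
    have h := (abs_le.mp (hΦ L.prod b)).2
    linarith
  rw [← hz]
  nlinarith

/-! ## §3 Dictionary to the crux: the defect display, the proved glue, the open construction -/

/-- Admissibility of a datum `(P,l)` = exactly the hypotheses of `Cor22.Thm110Legendre` (P ∈ U, l ≥ 5 prime, core, (P2), (P5), (P6)). -/
def Adm (P : NFPoint) (l : ℕ) : Prop :=
  P ∈ UP ∧ l.Prime ∧ 5 ≤ l ∧ Cor22.AdmitsCore P ∧ Cor22.CondP2 P l ∧ Cor22.CondP5 P l ∧ Cor22.CondP6 P l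

/-- **DEFECT DISPLAY with free constants `(κ₁, c₀)`**: `(1/6)·log q^{∤{2,l}} ≤ (1 + κ₁·d_mod/l)·(log-diff + log-cond) + c₀·d_mod·l` at
every admissible `(P,l)` — the output shape of a level-`l` bounded-defect law (credit per factor summed over the bad places = the
`(1 + κ₁ d_mod/l)·(conductor + different)` share; total defect `c₀·d_mod·l`). The multiplicative `κ₁/l` and the additive `O(l)` keep it
OUTSIDE the proved barrier `Literature.Barriers.ABC.SzpiroEpsilonCannotBeDropped` (Masser 1990: no `|D| ≤ C·N⁶(log N)^k`) — with
`κ₁ = c₀·l = O(1)` at a fixed small `l` it would be Masser-false. A HYPOTHESIS SHAPE; asserted nowhere. -/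
def DefectDisplay (κ₁ c₀ : ℝ) : Prop :=
  ∀ P : NFPoint, ∀ l : ℕ, Adm P l →
    1 / 6 * Cor22.logQAvoid P {2, l} ≤ (1 + κ₁ * (Cor22.dmod P : ℝ) / l) * (P.logDiff + Cor22.logCondAvoid P {2, l}) + c₀ * (Cor22.dmod P : ℝ) * l

/-- GLUE (proved): a defect display with `κ₁ ≤ 20` and `c₀ ≤ 20·2¹²·3³·5` implies `Cor22.Thm110Legendre` (uses only `log-diff ≥ 0`,
`log-cond ≥ 0`, `d_mod ≥ 1`, `l ≥ 5`, `η > 0`). -/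
theorem thm110Legendre_of_defectDisplay {κ₁ c₀ : ℝ} (hκ : κ₁ ≤ 20) (hc : c₀ ≤ 20 * (2 ^ 12 * 3 ^ 3 * 5))
    (h : DefectDisplay κ₁ c₀) : Cor22.Thm110Legendre := by
  intro η hη P hP l hl h5 hcore h2 h5' h6
  have hD := h P l ⟨hP, hl, h5, hcore, h2, h5', h6⟩
  have hη0 : 0 < η := hη.1
  have hdm : (1 : ℝ) ≤ (Cor22.dmod P : ℝ) := by exact_mod_cast Cor22.dmod_pos P
  have hl5 : (5 : ℝ) ≤ (l : ℝ) := by exact_mod_cast h5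
  have hlpos : (0 : ℝ) < (l : ℝ) := by linarith
  have hX : 0 ≤ P.logDiff + Cor22.logCondAvoid P {2, l} := add_nonneg (NFPoint.logDiff_nonneg P) (Cor22.logCondAvoid_nonneg P _)
  have hdl : 0 ≤ (Cor22.dmod P : ℝ) / l := by positivity
  have hfac : 1 + κ₁ * (Cor22.dmod P : ℝ) / l ≤ 1 + 20 * (Cor22.dmod P : ℝ) / l := by
    have : κ₁ * ((Cor22.dmod P : ℝ) / l) ≤ 20 * ((Cor22.dmod P : ℝ) / l) := mul_le_mul_of_nonneg_right hκ hdl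
    have e1 : κ₁ * (Cor22.dmod P : ℝ) / l = κ₁ * ((Cor22.dmod P : ℝ) / l) := by ring
    have e2 : (20 : ℝ) * (Cor22.dmod P : ℝ) / l = 20 * ((Cor22.dmod P : ℝ) / l) := by ring
    linarith
  have hdlpos : 0 ≤ (Cor22.dmod P : ℝ) * l := by positivity
  have hadd : c₀ * (Cor22.dmod P : ℝ) * l ≤ 20 * (2 ^ 12 * 3 ^ 3 * 5 * (Cor22.dmod P : ℝ) * l + η) := by
    have : c₀ * ((Cor22.dmod P : ℝ) * l) ≤ 20 * (2 ^ 12 * 3 ^ 3 * 5) * ((Cor22.dmod P : ℝ) * l) := mul_le_mul_of_nonneg_right hc hdlpos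
    nlinarith
  unfold Cor22.Display
  have h1 := mul_le_mul_of_nonneg_right hfac hX
  linarith

/-- ASSEMBLY INSIDE THE ROUTE (proved): an admissible defect display decides the crux `ThetaPartII` BY NAME, through the landed
`Summit.ABC.ABC.Theorems.ThetaPartII_of_thm110Legendre` (abc-iut-S3 / S-d). -/
theorem thetaPartII_of_defectDisplay {κ₁ c₀ : ℝ} (hκ : κ₁ ≤ 20) (hc : c₀ ≤ 20 * (2 ^ 12 * 3 ^ 3 * 5))
    (h : DefectDisplay κ₁ c₀) : Summit.ABC.ABC.Theses.IUTThetaPilot.ThetaPartII :=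
  Summit.ABC.ABC.Theorems.ThetaPartII_of_thm110Legendre (thm110Legendre_of_defectDisplay hκ hc h)

/-- WHY A DEFECT LAW CANNOT BE CARRIED BY A HOMOMORPHISM (the non-triviality lever, proved): a letter whose value is bounded UNIFORMLY IN
ITS EXPONENT is invisible to every additive functional — `(∀ n, |n·a| ≤ w) → a = 0`. So in a defect-law model the height is carried by the
DEFECT (commutator) part of `Φ`, never by a character: abelian / amenable `G` are excluded as soon as admissible heights are unbounded. -/
theorem letters_invisible_to_homs (a w : ℝ) (h : ∀ n : ℕ, |(n : ℝ) * a| ≤ w) : a = 0 := by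
  by_contra ha
  have ha' : 0 < |a| := abs_pos.mpr ha
  obtain ⟨n, hn⟩ := exists_nat_gt (w / |a|)
  have h1 := h n
  rw [abs_mul, Nat.abs_cast] at h1
  have h2 : w < n * |a| := by rwa [div_lt_iff₀ ha'] at hn
  linarith

/-- **THE IDENTIFICATION OBJECT — interface of a level-`l` DEFECT LAW (the CONSTRUCTION is the open content).** ONE group `G` with ONE
bounded-defect functional `Φ` (defect `δ`, `Φ 1 = 0`; «rotation number»); a `P`-INDEPENDENT alphabet of local generators `gen t`
(`t : ι` = place types, «local monodromy / Dehn twist at a place of type t») with `P`-independent weights `w t` («log N𝔭-scale»), subject to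
the PARABOLIC BOUND `|Φ(g · gen t ^ n · g⁻¹)| ≤ w t` UNIFORM IN THE EXPONENT `n` AND THE CONJUGATOR `g` (Bogomolov (B1): the lift of a
unipotent displaces by `< π` WHATEVER its power — credit per FACTOR, height-free; by `letters_invisible_to_homs` this is what forces the
height into the defect part); and at every ADMISSIBLE `(P,l)` an EULER WORD: letters `conj · gen(typ) ^ expn · conj⁻¹` (one per bad-place
factor, exponent = the local height, read at level `l`), whose weights total at most the `(1 + κ₁ d_mod/l)·(log-diff + log-cond)` share, a
boundary letter of rotation `≤ B`, and a CENTRAL CLOSING `ctr ^ deg = word · bdry` whose rotation is EXACTLY `(1/6)·log q^{∤{2,l}}` (the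
additive/degree side — Bogomolov (B4): `χ` a genuine homomorphism), with defect budget `nfac·δ + B + δ ≤ c₀·d_mod·l`.
No cell, no label `j`, no q-pilot or Θ-pilot region is ever compared: consistency of the two «pilots» is automatic because both are values of the
SAME functional on the SAME group element (`hrel`). For number fields the missing piece is exactly `(G, Φ, hrel)`: profinite completions
kill rotation numbers (compact ⇒ bounded ⇒ zero defect class), i.e. «no archimedean monodromy» — interface ≠ construction. -/
structure DefectLawModel (G : Type*) [Group G] (κ₁ c₀ : ℝ) where
  Φ : G → ℝ
  δ : ℝ
  B : ℝ
  quasi : IsQuasimorphism Φ δ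
  one : Φ 1 = 0
  /-- place types, their local generators and height-free weights (all `P`-independent) -/
  ι : Type
  gen : ι → G
  w : ι → ℝ
  hw : ∀ t, 0 ≤ w t
  /-- THE DEFECT-LAW SIGNATURE: parabolic bound uniform in exponent and conjugator -/
  hpar : ∀ (t : ι) (g : G) (n : ℕ), |Φ (g * gen t ^ n * g⁻¹)| ≤ w t
  /-- the Euler word of a datum: `nfac` letters `conj i · gen (typ i) ^ expn i · (conj i)⁻¹`, a boundary letter, a central closing -/
  nfac : NFPoint → ℕ → ℕ
  typ : NFPoint → ℕ → ℕ → ι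
  expn : NFPoint → ℕ → ℕ → ℕ
  conj : NFPoint → ℕ → ℕ → G
  bdry : NFPoint → ℕ → G
  ctr : NFPoint → ℕ → G
  deg : NFPoint → ℕ → ℕ
  c : NFPoint → ℕ → ℝ
  /-- the letters' weights total at most the (conductor + different) share, with the level-`l` multiplicative loss -/
  hwt : ∀ P l, Adm P l → ∑ i ∈ Finset.range (nfac P l), w (typ P l i) ≤
    (1 + κ₁ * (Cor22.dmod P : ℝ) / l) * (P.logDiff + Cor22.logCondAvoid P {2, l})
  hbdry : ∀ P l, Adm P l → Φ (bdry P l) ≤ B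
  /-- degree side, EXACT: the central closing rotates by the q-height -/
  hdeg : ∀ P l, Adm P l → Φ (ctr P l ^ deg P l) = deg P l * c P l
  hdegq : ∀ P l, Adm P l → (deg P l : ℝ) * c P l = 1 / 6 * Cor22.logQAvoid P {2, l}
  /-- THE GLOBAL RELATION (the analogue of `π₁` of the base curve; for number fields: the missing object): the Euler word closes -/
  hrel : ∀ P l, Adm P l → ctr P l ^ deg P l =
    ((List.range (nfac P l)).map (fun i => conj P l i * gen (typ P l i) ^ expn P l i * (conj P l i)⁻¹)).prod * bdry P l
  /-- the defect budget, linear in `l` like print's `d*_mod·l` term -/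
  hbudget : ∀ P l, Adm P l → (nfac P l : ℝ) * δ + B + δ ≤ c₀ * (Cor22.dmod P : ℝ) * l

/-- bookkeeping: a `List.range` sum is a `Finset.range` sum. -/
theorem sum_map_range (g : ℕ → ℝ) : ∀ n : ℕ, ((List.range n).map g).sum = ∑ i ∈ Finset.range n, g i
  | 0 => by simp
  | n + 1 => by
    rw [List.range_succ, List.map_append, List.sum_append, Finset.sum_range_succ, sum_map_range g n]
    simp

/-- **FIRST LEMMA OF THE LINE (proved): a defect-law model yields the defect display** — the Euler-word closing inequality
(`eulerWord_closing` shape) read through the dictionary: letters = bad-place factors, weights = conductor + different share, central closing =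
q-height; PRICE PER FACTOR, PAYOFF PER DEGREE, no label axis. -/
theorem defectDisplay_of_model {G : Type*} [Group G] {κ₁ c₀ : ℝ} (M : DefectLawModel G κ₁ c₀) : DefectDisplay κ₁ c₀ := by
  intro P l hA
  set L := (List.range (M.nfac P l)).map (fun i => M.conj P l i * M.gen (M.typ P l i) ^ M.expn P l i * (M.conj P l i)⁻¹) with hL
  have hlen : (L.length : ℝ) = M.nfac P l := by simp [hL]
  have hq := (abs_le.mp (quasimorphism_prod_le M.quasi M.one L)).2
  have hsum : (L.map M.Φ).sum = ∑ i ∈ Finset.range (M.nfac P l), M.Φ (M.conj P l i * M.gen (M.typ P l i) ^ M.expn P l i * (M.conj P l i)⁻¹) := by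
    rw [hL, List.map_map]
    exact sum_map_range _ (M.nfac P l)
  have hletters : (L.map M.Φ).sum ≤ ∑ i ∈ Finset.range (M.nfac P l), M.w (M.typ P l i) := by
    rw [hsum]
    exact Finset.sum_le_sum fun i _ => (le_abs_self _).trans (M.hpar _ _ _)
  have hX := M.hwt P l hA
  have hb := M.hbdry P l hA
  have hstep := (abs_le.mp (M.quasi L.prod (M.bdry P l))).2
  have hdeg : M.Φ (M.ctr P l ^ M.deg P l) = 1 / 6 * Cor22.logQAvoid P {2, l} := by rw [M.hdeg P l hA, M.hdegq P l hA]
  have hrel : M.Φ (M.ctr P l ^ M.deg P l) = M.Φ (L.prod * M.bdry P l) := by rw [M.hrel P l hA]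
  have hbud := M.hbudget P l hA
  rw [hlen] at hq
  linarith

/-- CONSTRUCTION STATEMENT (the crux content relocated; OPEN; asserted nowhere): a level-`l` defect-law model with Thm-1.10-admissible
constants exists. NOT cheaply inhabitable: `hpar` + `letters_invisible_to_homs` exclude characters, `hbudget` caps the number of letters, and
`hdegq` makes `Φ` unbounded on closings — so a model forces a genuinely non-abelian bounded-defect class nontrivial on the Euler words. -/
def DefectLawModelExists : Prop :=
  ∃ (G : Type) (_ : Group G) (κ₁ c₀ : ℝ), κ₁ ≤ 20 ∧ c₀ ≤ 20 * (2 ^ 12 * 3 ^ 3 * 5) ∧ Nonempty (DefectLawModel G κ₁ c₀)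

/-- The open/closed split, kernel-checked: MODEL (open construction) ⟹ DISPLAY ⟹ `Thm110Legendre` ⟹ `ThetaPartII`. -/
theorem thetaPartII_of_model {G : Type*} [Group G] {κ₁ c₀ : ℝ} (hκ : κ₁ ≤ 20) (hc : c₀ ≤ 20 * (2 ^ 12 * 3 ^ 3 * 5))
    (M : DefectLawModel G κ₁ c₀) : Summit.ABC.ABC.Theses.IUTThetaPilot.ThetaPartII :=
  thetaPartII_of_defectDisplay hκ hc (defectDisplay_of_model M)

/-- … and from the construction statement. -/
theorem thetaPartII_of_modelExists (h : DefectLawModelExists) : Summit.ABC.ABC.Theses.IUTThetaPilot.ThetaPartII := by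
  obtain ⟨G, _, κ₁, c₀, h₁, h₂, ⟨M⟩⟩ := h
  exact thetaPartII_of_model h₁ h₂ M


/-! ## §4 (I3-CRIT-A, critic abc-iut-crit-A) KERNEL NO-GO FOR THE INTERFACE ABOVE (made UNCONDITIONAL in §5: `not_defectLawModelExists`, `defectLawModel_isEmpty`) — appended to a VERBATIM copy (namespace renamed `DefectLawCritA`)
of Cruxes/ThetaPartII/DefectLawBookingSketch.lean ca8280f1d023af3d, because Cruxes modules are not built on the farm (import refused `unbuilt`). -/

/-
# I3-CRIT-A (critic abc-iut-crit-A) — kernel no-go for the crux card `defect-law-booking` (abc-iut-idea-1) on `ThetaPartII`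

The card's interface `DefectLawModel G κ₁ c₀` (Cruxes/ThetaPartII/DefectLawBookingSketch.lean ca8280f1d023af3d) books the
identification «once per FACTOR»: a letter `g · gen t ^ n · g⁻¹` is credited `w t` UNIFORMLY IN THE EXPONENT (`hpar`), the credits
total the conductor+different share (`hwt`), and the DEFECTS `nfac·δ + B + δ` are charged to the `c₀·d_mod·l` budget (`hbudget`).

THE NO-GO (homogenisation of quasimorphisms, three lines of real arithmetic): if `Φ` has defect `δ` and `Φ` is bounded above on ALL
powers of `x`, then `Φ x ≤ δ` (`le_defect_of_pow_bounded`: `n·Φ x ≤ Φ(xⁿ) + (n−1)·δ`). By `hpar` every letter of every Euler word is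
such an `x` (its powers are again conjugates of powers of `gen t`, `conj_pow`), so EVERY LETTER IS WORTH AT MOST `δ` — exactly what it
COSTS in `hbudget`. Hence any model forces, at every admissible `(P,l)`,
`(1/6)·log q^{∤{2,l}} ≤ 2·c₀·d_mod·l − B − δ` (`logQAvoid_le_of_model`): NO conductor / different credit is ever earned; the
typed law books `O(l)`, not `O(h)`. Consequently `DefectLawModelExists` is false as soon as admissible data of q-height exceeding
every multiple of `d_mod·l` exist (`not_defectLawModelExists_of_unboundedAdmissibleHeight`; the hypothesis is stated as a `Prop`,
not constructed here — constructing admissible `NFPoint`s with (P6) is the tree's `FreyLegendreP6Engine…` business, not a critic's).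

No side taken on [IUTchIII] Cor. 3.12 (D-0045); this refutes a TYPED INTERFACE of an idea card, not a statement of the route;
typed ≠ proved for the crux; computed ≠ proved; NO abc claim.
-/



/-- Powers under a quasimorphism: `n·Φ x ≤ Φ (x^n) + (n−1)·δ` for `n ≥ 1` (stated as `(n+1)·Φ x ≤ Φ(x^(n+1)) + n·δ`). -/
theorem succ_mul_le_pow {G : Type*} [Group G] {Φ : G → ℝ} {δ : ℝ} (hΦ : IsQuasimorphism Φ δ) (x : G) :
    ∀ n : ℕ, ((n : ℝ) + 1) * Φ x ≤ Φ (x ^ (n + 1)) + n * δ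
  | 0 => by simp
  | n + 1 => by
    have ih := succ_mul_le_pow hΦ x n
    have h := (abs_le.mp (hΦ (x ^ (n + 1)) x)).1
    rw [← pow_succ] at h
    push_cast
    nlinarith

/-- The defect of a quasimorphism is nonnegative. -/
theorem defect_nonneg {G : Type*} [Group G] {Φ : G → ℝ} {δ : ℝ} (hΦ : IsQuasimorphism Φ δ) : 0 ≤ δ :=
  le_trans (abs_nonneg _) (hΦ 1 1)

/-- **Letters are worth at most the defect.** If `Φ` (defect `δ`) is bounded above by `w` on all powers of `x`, then `Φ x ≤ δ`:
homogenisation — a functional bounded on `⟨x⟩` has homogenisation `0` there, and `Φ` is within `δ` of it. -/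
theorem le_defect_of_pow_bounded {G : Type*} [Group G] {Φ : G → ℝ} {δ w : ℝ} (hΦ : IsQuasimorphism Φ δ) (x : G)
    (hw : ∀ n : ℕ, Φ (x ^ n) ≤ w) : Φ x ≤ δ := by
  by_contra hlt
  push Not at hlt
  -- pick n with n·(Φ x − δ) > w + Φ x; then (n+1)Φ x ≤ Φ(x^(n+1)) + nδ ≤ w + nδ contradicts
  obtain ⟨n, hn⟩ := exists_nat_gt ((w - Φ x) / (Φ x - δ))
  have hpos : 0 < Φ x - δ := by linarith
  have h1 := succ_mul_le_pow hΦ x n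
  have h2 := hw (n + 1)
  have h3 : (w - Φ x) / (Φ x - δ) * (Φ x - δ) = w - Φ x := div_mul_cancel₀ _ (ne_of_gt hpos)
  have h4 : (w - Φ x) < n * (Φ x - δ) := by
    have := mul_lt_mul_of_pos_right hn hpos
    linarith
  nlinarith

/-- Every LETTER of a defect-law model is worth at most `δ`: `Φ (g · gen t ^ e · g⁻¹) ≤ δ` (by `hpar` on all powers and `conj_pow`). -/
theorem letter_le_defect {G : Type*} [Group G] {κ₁ c₀ : ℝ} (M : DefectLawModel G κ₁ c₀) (t : M.ι) (g : G) (e : ℕ) :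
    M.Φ (g * M.gen t ^ e * g⁻¹) ≤ M.δ := by
  refine le_defect_of_pow_bounded M.quasi _ (w := M.w t) fun n => ?_
  rw [conj_pow, ← pow_mul]
  exact (le_abs_self _).trans (M.hpar t g (e * n))

/-- **THE NO-GO.** A defect-law model books NO conductor/different credit: at every admissible `(P,l)`,
`(1/6)·log q^{∤{2,l}} ≤ 2·c₀·d_mod·l − B − δ` — the height is bounded by the `O(d_mod·l)` budget ALONE. -/
theorem logQAvoid_le_of_model {G : Type*} [Group G] {κ₁ c₀ : ℝ} (M : DefectLawModel G κ₁ c₀) (P : NFPoint) (l : ℕ)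
    (hA : Adm P l) : 1 / 6 * Cor22.logQAvoid P {2, l} ≤ 2 * (c₀ * (Cor22.dmod P : ℝ) * l) - M.B - M.δ := by
  set L := (List.range (M.nfac P l)).map (fun i => M.conj P l i * M.gen (M.typ P l i) ^ M.expn P l i * (M.conj P l i)⁻¹) with hL
  have hlen : (L.length : ℝ) = M.nfac P l := by simp [hL]
  have hq := (abs_le.mp (quasimorphism_prod_le M.quasi M.one L)).2
  have hsum : (L.map M.Φ).sum = ∑ i ∈ Finset.range (M.nfac P l),
      M.Φ (M.conj P l i * M.gen (M.typ P l i) ^ M.expn P l i * (M.conj P l i)⁻¹) := by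
    rw [hL, List.map_map]
    exact sum_map_range _ (M.nfac P l)
  have hletters : (L.map M.Φ).sum ≤ (M.nfac P l : ℝ) * M.δ := by
    rw [hsum]
    have : ∑ i ∈ Finset.range (M.nfac P l), M.Φ (M.conj P l i * M.gen (M.typ P l i) ^ M.expn P l i * (M.conj P l i)⁻¹)
        ≤ ∑ _i ∈ Finset.range (M.nfac P l), M.δ := Finset.sum_le_sum fun i _ => letter_le_defect M _ _ _
    simpa using this
  have hb := M.hbdry P l hA
  have hstep := (abs_le.mp (M.quasi L.prod (M.bdry P l))).2
  have hdeg : M.Φ (M.ctr P l ^ M.deg P l) = 1 / 6 * Cor22.logQAvoid P {2, l} := by rw [M.hdeg P l hA, M.hdegq P l hA]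
  have hrel : M.Φ (M.ctr P l ^ M.deg P l) = M.Φ (L.prod * M.bdry P l) := by rw [M.hrel P l hA]
  have hbud := M.hbudget P l hA
  rw [hlen] at hq
  linarith

/-- Admissible data whose q-height (away from `{2,l}`) exceeds every multiple of `d_mod·l`: the negation of «Szpiro with ZERO
conductor term». PROVED in §5 below (`unboundedAdmissibleHeight`) from the tree's own [IUTchIV] Cor 2.2 (ii) witnesses: the point
`λ_k = 1/2 + 2/7^k` with the prime `l` in the (P1) window `√h ≤ l ≤ 10δ₁√h·log(2δ₁h)`. -/
def UnboundedAdmissibleHeight : Prop :=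
  ∀ c : ℝ, ∃ (P : NFPoint) (l : ℕ), Adm P l ∧ c * ((Cor22.dmod P : ℝ) * l) < 1 / 6 * Cor22.logQAvoid P {2, l}

/-- **Corollary.** Modulo unbounded admissible height, the card's construction statement is FALSE for every group `G`:
`DefectLawModelExists` would bound every admissible q-height by `(2·c₀ + |B| + |δ|)·d_mod·l`. -/
theorem not_defectLawModelExists_of_unboundedAdmissibleHeight (hU : UnboundedAdmissibleHeight) : ¬ DefectLawModelExists := by
  rintro ⟨G, _, κ₁, c₀, _, _, ⟨M⟩⟩
  obtain ⟨P, l, hA, hc⟩ := hU (2 * c₀ + |M.B| + |M.δ|)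
  have h := logQAvoid_le_of_model M P l hA
  have hdl : (1 : ℝ) ≤ (Cor22.dmod P : ℝ) * l := by
    have hd : (1 : ℝ) ≤ (Cor22.dmod P : ℝ) := by exact_mod_cast Cor22.dmod_pos P
    have hl : (1 : ℝ) ≤ (l : ℝ) := by
      have := hA.2.2.1
      exact_mod_cast (le_trans (by norm_num : 1 ≤ 5) this)
    nlinarith
  have hB : -M.B ≤ |M.B| * ((Cor22.dmod P : ℝ) * l) := by
    have := neg_le_abs M.B
    nlinarith [abs_nonneg M.B]
  have hδ : -M.δ ≤ |M.δ| * ((Cor22.dmod P : ℝ) * l) := by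
    have := neg_le_abs M.δ
    nlinarith [abs_nonneg M.δ]
  nlinarith



/-! ## §5 (I3-CRIT-A) `UnboundedAdmissibleHeight` HOLDS — so the no-go of §4 is UNCONDITIONAL
The admissible pairs are the tree's OWN ([IUTchIV] Cor 2.2 (ii) proof, (P1)–(P6) pp. 45–46): the explicit point `ratPoint λ_k`,
`λ_k = 1/2 + 2/7^k` (`Corollary22Thm110LegendreWitness`, `Corollary22LegendreDeepAdmissiblePairs`), with the prime `l` taken by the
Chebyshev selection `Cor22.exists_prime_P1_P2_P3_point` INSIDE the (P1) window `√h ≤ l ≤ 10δ₁·√h·log(2δ₁h)` (so (P2) holds with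
`l = o(h)`), (P5) at the place over `7`, (P6) by `Cor22.condP6_of_seven_le`; the place over `7` alone gives
`log q^{∤{2,l}}(λ_k) ≥ 2k·log 7 ≥ (h − 12·log 2)/3`, and `d_mod = 1`. Hence `log q^{∤{2,l}}/(d_mod·l) → ∞` along admissible data. -/

open NumberField IsDedekindDomain

/-- `d_mod = 1` at a `ℚ`-point (`ℚ(j(λ)) ⊆ ℚ`). -/
theorem dmod_ratPoint (q : ℚ) : Cor22.dmod (ratPoint q) = 1 := by
  unfold Cor22.dmod
  rw [IntermediateField.finrank_eq_one_iff, IntermediateField.adjoin_simple_eq_bot_iff, IntermediateField.mem_bot]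
  exact ⟨Cor22.jInv (ratPoint q).x, rfl⟩

/-- Real-analysis line: `K·√h·log(2δ₁h) < (h − 12·log 2)/18` for all large `h` (`K ≥ 0`). -/
theorem sqrt_mul_log_lt_eventually (K : ℝ) (hK : 0 ≤ K) :
    ∃ H₀ : ℝ, ∀ h : ℝ, H₀ ≤ h →
      K * (Real.sqrt h * Real.log (2 * Cor22.delta 1 * h)) < (h - 12 * Real.log 2) / 18 := by
  have hA : (2 : ℝ) ≤ 2 * Cor22.delta 1 := by simp only [Cor22.delta]; norm_num
  refine ⟨(18 * (K * (2 * Cor22.delta 1 + 4)) + 9) ^ 4, fun h hh => ?_⟩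
  have hM0 : 0 ≤ 18 * (K * (2 * Cor22.delta 1 + 4)) := by positivity
  have hT0 : 0 ≤ 18 * (K * (2 * Cor22.delta 1 + 4)) + 9 := by positivity
  have hh0 : 0 < h := lt_of_lt_of_le (by positivity) hh
  have hs : Real.sqrt h ^ 2 = h := Real.sq_sqrt hh0.le
  have ht : Real.sqrt (Real.sqrt h) ^ 2 = Real.sqrt h := Real.sq_sqrt (Real.sqrt_nonneg h)
  have hsT : (18 * (K * (2 * Cor22.delta 1 + 4)) + 9) ^ 2 ≤ Real.sqrt h := by
    have h1 : Real.sqrt ((18 * (K * (2 * Cor22.delta 1 + 4)) + 9) ^ 4) ≤ Real.sqrt h := Real.sqrt_le_sqrt hh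
    rwa [show (18 * (K * (2 * Cor22.delta 1 + 4)) + 9) ^ 4 = ((18 * (K * (2 * Cor22.delta 1 + 4)) + 9) ^ 2) ^ 2 by ring,
      Real.sqrt_sq (by positivity)] at h1
  have htT : 18 * (K * (2 * Cor22.delta 1 + 4)) + 9 ≤ Real.sqrt (Real.sqrt h) := by
    have h1 : Real.sqrt ((18 * (K * (2 * Cor22.delta 1 + 4)) + 9) ^ 2) ≤ Real.sqrt (Real.sqrt h) := Real.sqrt_le_sqrt hsT
    rwa [Real.sqrt_sq hT0] at h1
  set t := Real.sqrt (Real.sqrt h) with ht_def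
  have ht9 : 9 ≤ t := le_trans (by linarith) htT
  have ht0 : 0 < t := by linarith
  have hht : h = t ^ 4 := by nlinarith [hs, ht]
  have hlogA : Real.log (2 * Cor22.delta 1) ≤ 2 * Cor22.delta 1 - 1 := Real.log_le_sub_one_of_pos (by linarith)
  have hlogt : Real.log t ≤ t - 1 := Real.log_le_sub_one_of_pos ht0
  have hlogh : Real.log h = 4 * Real.log t := by rw [hht, Real.log_pow]; push_cast; ring
  have hlog : Real.log (2 * Cor22.delta 1 * h) ≤ (2 * Cor22.delta 1 + 4) * t := by
    rw [Real.log_mul (by linarith) hh0.ne', hlogh]; nlinarith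
  have hsq : Real.sqrt h = t ^ 2 := by rw [← ht]
  have hL : K * (Real.sqrt h * Real.log (2 * Cor22.delta 1 * h)) ≤ K * (2 * Cor22.delta 1 + 4) * t ^ 3 := by
    have h1 : Real.sqrt h * Real.log (2 * Cor22.delta 1 * h) ≤ Real.sqrt h * ((2 * Cor22.delta 1 + 4) * t) :=
      mul_le_mul_of_nonneg_left hlog (Real.sqrt_nonneg h)
    have h2 := mul_le_mul_of_nonneg_left h1 hK
    calc K * (Real.sqrt h * Real.log (2 * Cor22.delta 1 * h)) ≤ K * (Real.sqrt h * ((2 * Cor22.delta 1 + 4) * t)) := h2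
      _ = K * (2 * Cor22.delta 1 + 4) * t ^ 3 := by rw [hsq]; ring
  have h2 : Real.log 2 < 1 := by linarith [Real.log_two_lt_d9]
  have ht3 : (729 : ℝ) ≤ t ^ 3 := by nlinarith
  have hkey : 18 * (K * (2 * Cor22.delta 1 + 4)) * t ^ 3 + 12 * Real.log 2 < t ^ 4 := by
    have e1 : t ^ 4 = t * t ^ 3 := by ring
    have e2 : (18 * (K * (2 * Cor22.delta 1 + 4)) + 9) * t ^ 3 ≤ t * t ^ 3 :=
      mul_le_mul_of_nonneg_right htT (by positivity)
    nlinarith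
  rw [hht] at *
  linarith

/-- **`UnboundedAdmissibleHeight` is a theorem**: along `λ_k = 1/2 + 2/7^k` with `l` in the (P1) window, `log q^{∤{2,l}}/(d_mod·l)` is
unbounded over admissible data `(P, l)` (`P ∈ UP`, `l ≥ 5` prime, core, (P2), (P5), (P6)). Assembled from the tree's witnesses. -/
theorem unboundedAdmissibleHeight : UnboundedAdmissibleHeight := by
  classical
  intro c
  have hS : ∀ p ∈ ({2} : Finset ℕ), p.Prime := by simp [Nat.prime_two]
  obtain ⟨ξ, hξ⟩ := exists_isXiPrm
  obtain ⟨HK, hHK⟩ := Cor22.condP6_of_seven_le (CBData.std {2} hS)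
  have hδ0 : (0 : ℝ) ≤ Cor22.delta 1 := by simp only [Cor22.delta]; norm_num
  have hK0 : 0 ≤ 10 * Cor22.delta 1 * max c 0 := mul_nonneg (mul_nonneg (by norm_num) hδ0) (le_max_right _ _)
  obtain ⟨H₀, hH₀⟩ := sqrt_mul_log_lt_eventually (10 * Cor22.delta 1 * max c 0) hK0
  obtain ⟨k, hk⟩ := exists_nat_gt (max (max (max HK (ξ ^ 2)) (max 64 H₀)) 2)
  have hk2r : (2 : ℝ) < k := lt_of_le_of_lt (le_max_right _ _) hk
  have hk2 : 2 ≤ k := by exact_mod_cast hk2r.le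
  have hk1 : 1 ≤ k := by omega
  have hmem := Cor22.ratPoint_lam_mem_std_two hk2 hS
  have hUP := Cor22.ratPoint_lamSeven_mem_UP hk1
  have hcore := Cor22.admitsCore_ratPoint_lam hk1
  have hlow := Cor22.two_mul_log_seven_le_logQForall_lam hk1
  have hup := Cor22.logQForall_ratPoint_lamSeven_le hk1
  have hlog7 : (1 : ℝ) ≤ Real.log 7 := by
    rw [Real.le_log_iff_exp_le (by norm_num)]
    linarith [Real.exp_one_lt_d9]
  have hk0 : (0 : ℝ) ≤ k := Nat.cast_nonneg k
  have hkh : (k : ℝ) ≤ Cor22.logQForall (ratPoint ((2 : ℚ)⁻¹ + 2 / 7 ^ k)) := by nlinarith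
  have hbig : max (max HK (ξ ^ 2)) (max 64 H₀) < Cor22.logQForall (ratPoint ((2 : ℚ)⁻¹ + 2 / 7 ^ k)) :=
    lt_of_lt_of_le (lt_of_le_of_lt (le_max_left _ _) hk) hkh
  have hHK' : HK < Cor22.logQForall (ratPoint ((2 : ℚ)⁻¹ + 2 / 7 ^ k)) :=
    lt_of_le_of_lt ((le_max_left _ _).trans (le_max_left _ _)) hbig
  have hξ2 : ξ ^ 2 < Cor22.logQForall (ratPoint ((2 : ℚ)⁻¹ + 2 / 7 ^ k)) :=
    lt_of_le_of_lt ((le_max_right _ _).trans (le_max_left _ _)) hbig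
  have h64 : (64 : ℝ) < Cor22.logQForall (ratPoint ((2 : ℚ)⁻¹ + 2 / 7 ^ k)) :=
    lt_of_le_of_lt ((le_max_left _ _).trans (le_max_right _ _)) hbig
  have hH₀' : H₀ ≤ Cor22.logQForall (ratPoint ((2 : ℚ)⁻¹ + 2 / 7 ^ k)) :=
    (lt_of_le_of_lt ((le_max_right _ _).trans (le_max_right _ _)) hbig).le
  have hξ0 : 0 ≤ ξ := le_trans (by norm_num) hξ.1
  have hξh : ξ ≤ Real.sqrt (Cor22.logQForall (ratPoint ((2 : ℚ)⁻¹ + 2 / 7 ^ k))) := by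
    rw [← Real.sqrt_sq hξ0]
    exact Real.sqrt_le_sqrt hξ2.le
  have hdeg : (ratPoint ((2 : ℚ)⁻¹ + 2 / 7 ^ k)).degree ≤ 1 := (degree_ratPoint _).le
  obtain ⟨l, hlp, hP1lo, hP1hi, hP2, -⟩ := Cor22.exists_prime_P1_P2_P3_point (ratPoint ((2 : ℚ)⁻¹ + 2 / 7 ^ k)) hdeg hξ hξh
  have h8 : (8 : ℝ) < Real.sqrt (Cor22.logQForall (ratPoint ((2 : ℚ)⁻¹ + 2 / 7 ^ k))) := by
    rw [show (8 : ℝ) = Real.sqrt (8 ^ 2) by rw [Real.sqrt_sq (by norm_num)]]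
    exact Real.sqrt_lt_sqrt (by norm_num) (by linarith [h64])
  have hl9 : 9 ≤ l := by
    have : (8 : ℝ) < l := h8.trans_le hP1lo
    exact_mod_cast this
  have hl7 : 7 ≤ l := by omega
  -- the place of `ℚ` over `7`
  let v : HeightOneSpectrum (𝓞 ℚ) := (Rat.HeightOneSpectrum.primesEquiv (R := 𝓞 ℚ)).symm ⟨7, by norm_num⟩
  have hv : Rat.HeightOneSpectrum.natGenerator v = 7 :=
    congrArg Subtype.val ((Rat.HeightOneSpectrum.primesEquiv (R := 𝓞 ℚ)).apply_symm_apply ⟨7, by norm_num⟩)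
  have hneg := Cor22.ord_jInv_lamSeven_neg v hv hk1
  have h2v : ¬ ((2 : ℕ) : 𝓞 ℚ) ∈ v.asIdeal := by
    rw [UniformABCConjecture.natCast_mem_asIdeal_iff, hv]; norm_num
  have hlv : ¬ ((l : ℕ) : 𝓞 ℚ) ∈ v.asIdeal := by
    rw [UniformABCConjecture.natCast_mem_asIdeal_iff, hv]
    intro h
    have : 7 = l := (Nat.prime_dvd_prime_iff_eq (by norm_num) hlp).1 h
    omega
  have hP5 : Cor22.CondP5 (ratPoint ((2 : ℚ)⁻¹ + 2 / 7 ^ k)) l := ⟨v, hneg, h2v, hlv⟩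
  have hP6 : Cor22.CondP6 (ratPoint ((2 : ℚ)⁻¹ + 2 / 7 ^ k)) l := hHK _ hmem hUP l hlp hl7 hP2 hP5 hHK'
  have hAdm : Adm (ratPoint ((2 : ℚ)⁻¹ + 2 / 7 ^ k)) l := ⟨hUP, hlp, by omega, hcore, hP2, hP5, hP6⟩
  -- `log q^{∤{2,l}} ≥ 2k·log 7` from the place over `7`
  have hbad : v ∈ Cor22.badPlaces (ratPoint ((2 : ℚ)⁻¹ + 2 / 7 ^ k)) :=
    (Cor22.mem_badPlaces_iff_ord_neg (ratPoint ((2 : ℚ)⁻¹ + 2 / 7 ^ k)) v).2 hneg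
  have hfilt : v ∈ (Cor22.badPlaces (ratPoint ((2 : ℚ)⁻¹ + 2 / 7 ^ k))).filter
      (fun w => ∀ p ∈ ({2, l} : Finset ℕ), ((p : ℕ) : 𝓞 (ratPoint ((2 : ℚ)⁻¹ + 2 / 7 ^ k)).F) ∉ w.asIdeal) := by
    refine Finset.mem_filter.2 ⟨hbad, fun p hp => ?_⟩
    rcases Finset.mem_insert.1 hp with rfl | hp
    · exact h2v
    · rw [Finset.mem_singleton] at hp
      subst hp
      exact hlv
  have hsingle : Cor22.localHeight (ratPoint ((2 : ℚ)⁻¹ + 2 / 7 ^ k)) v * logNorm ℚ v ≤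
      ((ratPoint ((2 : ℚ)⁻¹ + 2 / 7 ^ k)).degree : ℝ) * Cor22.logQAvoid (ratPoint ((2 : ℚ)⁻¹ + 2 / 7 ^ k)) {2, l} := by
    rw [Cor22.degree_mul_logQAvoid]
    exact Finset.single_le_sum (f := fun w => Cor22.localHeight (ratPoint ((2 : ℚ)⁻¹ + 2 / 7 ^ k)) w * logNorm _ w)
      (fun w _ => mul_nonneg (Cor22.localHeight_nonneg _ w) (logNorm_pos _ w).le) hfilt
  have hloc : Cor22.localHeight (ratPoint ((2 : ℚ)⁻¹ + 2 / 7 ^ k)) v = 2 * k := by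
    rw [Cor22.localHeight_eq_neg_ord hbad]
    change -((ord ℚ v (Cor22.jInv ((2 : ℚ)⁻¹ + 2 / 7 ^ k)) : ℤ) : ℝ) = 2 * (k : ℝ)
    rw [Cor22.ord_jInv_lamSeven v hv hk1]; push_cast; ring
  have hnorm : logNorm ℚ v = Real.log 7 := by
    rw [logNorm, UniformABCConjecture.absNorm_asIdeal_eq_natGenerator, hv]; norm_num
  have hdegP : ((ratPoint ((2 : ℚ)⁻¹ + 2 / 7 ^ k)).degree : ℝ) = 1 := by rw [degree_ratPoint]; simp
  have hQ : 2 * k * Real.log 7 ≤ Cor22.logQAvoid (ratPoint ((2 : ℚ)⁻¹ + 2 / 7 ^ k)) {2, l} := by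
    have := hsingle
    rw [hloc, hnorm, hdegP, one_mul] at this
    linarith
  have hd : (Cor22.dmod (ratPoint ((2 : ℚ)⁻¹ + 2 / 7 ^ k)) : ℝ) = 1 := by rw [dmod_ratPoint]; simp
  have hmain := hH₀ _ hH₀'
  have hl0 : (0 : ℝ) ≤ l := Nat.cast_nonneg l
  refine ⟨ratPoint ((2 : ℚ)⁻¹ + 2 / 7 ^ k), l, hAdm, ?_⟩
  calc c * ((Cor22.dmod (ratPoint ((2 : ℚ)⁻¹ + 2 / 7 ^ k)) : ℝ) * l) = c * l := by rw [hd, one_mul]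
    _ ≤ max c 0 * l := mul_le_mul_of_nonneg_right (le_max_left _ _) hl0
    _ ≤ max c 0 * (10 * Cor22.delta 1 * Real.sqrt (Cor22.logQForall (ratPoint ((2 : ℚ)⁻¹ + 2 / 7 ^ k))) *
          Real.log (2 * Cor22.delta 1 * Cor22.logQForall (ratPoint ((2 : ℚ)⁻¹ + 2 / 7 ^ k)))) :=
        mul_le_mul_of_nonneg_left hP1hi (le_max_right _ _)
    _ = 10 * Cor22.delta 1 * max c 0 * (Real.sqrt (Cor22.logQForall (ratPoint ((2 : ℚ)⁻¹ + 2 / 7 ^ k))) *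
          Real.log (2 * Cor22.delta 1 * Cor22.logQForall (ratPoint ((2 : ℚ)⁻¹ + 2 / 7 ^ k)))) := by ring
    _ < (Cor22.logQForall (ratPoint ((2 : ℚ)⁻¹ + 2 / 7 ^ k)) - 12 * Real.log 2) / 18 := hmain
    _ ≤ 1 / 6 * Cor22.logQAvoid (ratPoint ((2 : ℚ)⁻¹ + 2 / 7 ^ k)) {2, l} := by linarith

/-- **THE NO-GO, UNCONDITIONAL.** The card's construction statement `DefectLawModelExists` is FALSE: no group `G`, no
quasimorphism, no alphabet satisfies the typed interface `DefectLawModel G κ₁ c₀` (for ANY `κ₁, c₀`, in fact — the bounds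
`κ₁ ≤ 20`, `c₀ ≤ 20·δ₁` are not used). Axioms: standard. -/
theorem not_defectLawModelExists : ¬ DefectLawModelExists :=
  not_defectLawModelExists_of_unboundedAdmissibleHeight unboundedAdmissibleHeight

/-- Equivalently: the interface is uninhabited for every group and every pair of constants. -/
theorem defectLawModel_isEmpty (G : Type) [Group G] (κ₁ c₀ : ℝ) : IsEmpty (DefectLawModel G κ₁ c₀) := by
  refine ⟨fun M => ?_⟩
  obtain ⟨P, l, hA, hc⟩ := unboundedAdmissibleHeight (2 * c₀ + |M.B| + |M.δ|)
  have h := logQAvoid_le_of_model M P l hA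
  have hdl : (1 : ℝ) ≤ (Cor22.dmod P : ℝ) * l := by
    have hd : (1 : ℝ) ≤ (Cor22.dmod P : ℝ) := by exact_mod_cast Cor22.dmod_pos P
    have hl : (1 : ℝ) ≤ (l : ℝ) := by
      have := hA.2.2.1
      exact_mod_cast (le_trans (by norm_num : 1 ≤ 5) this)
    nlinarith
  have hB : -M.B ≤ |M.B| * ((Cor22.dmod P : ℝ) * l) := by
    have := neg_le_abs M.B
    nlinarith [abs_nonneg M.B]
  have hδ : -M.δ ≤ |M.δ| * ((Cor22.dmod P : ℝ) * l) := by
    have := neg_le_abs M.δ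
    nlinarith [abs_nonneg M.δ]
  nlinarith

end Summit.ABC.ABC.Cruxes.ThetaPartII.DefectLawCritA
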